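import Literature.NumberTheory.EllipticCurves.AnticyclotomicSignedTransferInputs
import Literature.NumberTheory.EllipticCurves.CastellaGrossiSkinner2025.GreenbergAnticyclotomicMainConjectureProofs
import Summits.BirchSwinnertonDyer.BirchSwinnertonDyer.Theorems.SignedBaseChangeAnticyclotomicEisensteinDivisibilityTransferTorsionFree
import HarnessLib

/-!
# Castella–Wan's `TransferInputs` ASSEMBLED from its three deep inputs — the named fact
# `castellaWan2024_proofThm68_transferInputs` (conjunct 3 of `stub_namedFactsSS`) REDUCED to
# {Lemma 6.7 (conjunct 4), (6.12), (6.13), Thm. 6.2 (ideal form), `L_p^BDP ≠ 0`}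
# (crux `AnticyclotomicEisensteinDivisibility`, stmt-BirchSwinnertonDyer-20727, line `bdpline`; helper)

Lead prover seat `bsd-line-sbc-p1` (gen 10), route `SignedBaseChange` of the BSD summit, `--supports`
stmt-BirchSwinnertonDyer-20727. The registered skeleton `Lines/bdpline.lean` (v33) closes the crux modulo its
stubs; `stub_namedFactsSS` is a conjunction of eleven typed named facts. Conjunct 3 is
`AcSigned.castellaWan2024_proofThm68_transferInputs` (Castella–Wan 2024, the inputs of the proof of Thm. 6.8),
which asserts for every sign the EXISTENCE of the six-field hypothesis structure `AcSigned.TransferInputs`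
(`Literature/…/AnticyclotomicSignedTransferInputs.lean`): `torsionFree` ([PR00, §1.3.3]), `exact613`,
`exact612` (the Poitou–Tate sequences (6.13), (6.12)), `lemma67` (Lemma 6.7 (2)), `signedLog_erl` (Def. 6.1 +
Thm. 6.2 as ideals), `loc_nonTorsion` (Cor. 6.4). Conjunct 4 is `AcSigned.castellaWan2024_lemma67_finrank_torsionCharIdeal`
(Lemma 6.7 itself, clauses (1), (2a), (2b)).

This file records, as KERNEL THEOREMS, how much of conjunct 3 is already carried elsewhere:

* `transferInputs_of_duality_of_erl` — in the `AcSigned.Setting`, the structure `TransferInputs … ε z L` is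
  ASSEMBLED from FOUR data: the two global-duality fields (6.13)/(6.12) (types VERBATIM), the Lemma-6.7 (2)
  field (type VERBATIM), and the explicit-reciprocity field `signedLog_erl` (type VERBATIM) together with
  `L ≠ 0`. The field `torsionFree` is the gen-9 theorem `transferInputs_torsionFree_of_setting`
  ([PR00, §1.3.3] on the tree's carriers, p664187/p664605) and the field `loc_nonTorsion` (Cor. 6.4) is
  DERIVED exactly as print derives it ("Immediate from Theorem 6.2 and the non-vanishing result for
  `𝓛^BDP_𝔭` in Theorem 2.3", MS p. 27): `AcSigned.smul_locSignedAt_eq_zero_imp_of_erl` along the structure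
  map `ℤ_p → R₀` of `exists_ringHom_padicInt_unrIntegers`.
* `lemma67Field_of_lemma67Fact` — the `lemma67` field of the structure IS clause (2) of conjunct 4 (same
  carriers, same module structures, same binders): conjunct 4 BY NAME delivers it in the `Setting` under the
  fact's printed hypotheses (`N = N_E`, Heegner hypothesis, `3 < p`).
* `proofThm68_transferInputs_of_lemma67_of_dualityERL` — **conjunct 3 BY NAME from conjunct 4 BY NAME and ONE
  inline statement `DualityERL`** = "in the Setting, for the newform of `W`, there is a Castella–Wan frame
  `(Ω_K ≠ 0, Ω_p, L)` with `IsCWBDPLFunction … L` and `L ≠ 0` such that for each sign there is a class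
  `z ∈ Sel_ε(K, 𝐓^ac)` with (6.13), (6.12) and the ideal form of Thm. 6.2" — i.e. print's (6.12), (6.13),
  Thm. 6.2 and Thm. 2.3 (`μ(𝓛^BDP_𝔭) = 0`, here only `L ≠ 0`), and NOTHING ELSE. The inline statement is
  spelled out as the hypothesis `hD` (no new `def … : Prop`; the gate's INPUTS convention).

NET for the line's trust base (numbers, not adjectives): of the six bundled inputs of conjunct 3, ONE is a
theorem (torsionFree, gen 9), ONE is a duplicate of conjunct 4 (lemma67), ONE is derived (loc_nonTorsion ⟸
Thm. 6.2 + `L ≠ 0`); THREE remain literature inputs: (6.12), (6.13) (`Λ^ac`-adic Poitou–Tate for the signed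
conditions) and Thm. 6.2 (the signed explicit reciprocity law), plus the non-vanishing `L ≠ 0` (Thm. 2.3,
[Hsi14]/[Bur17] — on the line this is Burungale–Castella–Skinner 2025 Prop. 4.2.2, conjunct 10, up to the
frame concordance of `…FrameConcordance.lean`). HONEST FRAMING: the named fact is NOT discharged and its text is
unchanged; the skeleton of record is unchanged; nothing of the crux's research stubs is proved; BSD is not
proved by any of this; no summit statement is proved by this seat.

References: [CastellaWan2023] F. Castella, X. Wan, *Perrin-Riou's main conjecture for elliptic curves at
supersingular primes*, Math. Ann. 389 (2024) (accepted MS `paper:url-7157bd4f7b88`): proof of Thm. 6.8 with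
(6.12)–(6.13) (MS pp. 29–31), Def. 6.1 / Thm. 6.2 (MS pp. 25–26), Cor. 6.4 (MS p. 27), Lemma 6.7 (MS p. 28),
Thm. 2.3 (MS p. 7); [PerrinRiou1995Asterisque] §1.3.3; [Castella2018] §3 (the structure map `ℤ_p → R₀`).
-/

set_option autoImplicit false
-- `…BirchSwinnertonDyer.BirchSwinnertonDyer.Theorems…` is the problem's mandated namespace (D-0017).
set_option linter.dupNamespace false

noncomputable section

open scoped Classical

namespace Summit.BirchSwinnertonDyer.BirchSwinnertonDyer.Theorems.SignedBaseChangeAcDivTransferInputsOfDuality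

open PowerSeries NumberField IsDedekindDomain Field WeierstrassCurve
open Literature.NumberTheory.EllipticCurves Literature.NumberTheory.GaloisRepresentations
open Literature.NumberTheory.EllipticCurves.ModularForms Literature.NumberTheory.EllipticCurves.Castella2018
open Literature.NumberTheory.EllipticCurves.CastellaWan2024
open Literature.NumberTheory.EllipticCurves.AcSigned
open Summit.BirchSwinnertonDyer.BirchSwinnertonDyer.Theorems.SignedBaseChangeAcDivTransferTorsionFree

/-! ## §1. The structure from its four deep data, in the `Setting` -/

section Assembly

variable {W : WeierstrassCurve ℚ} [W.IsGloballyMinimal] {K : Type} [Field K] [NumberField K]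
  {p : ℕ} [Fact p.Prime] {κ : ZpExtension K p} {𝔭 𝔭' : HeightOneSpectrum (𝓞 K)}

/-- **`TransferInputs` assembled**: in Castella–Wan's `Setting` (`a_p = 0`, `p = 𝔭𝔭'` split, `κ`
anticyclotomic, `p ∤ h_K`), for a topological generator `γ`, a prime `𝔭` with one prime of `K_∞` above it and
matching local generator `γ_𝔭`, a sign `ε`, a class `z ∈ Sel_ε(K, 𝐓^ac)` and `L ∈ R₀⟦T⟧` with `L ≠ 0`: the
data (6.13), (6.12), Lemma 6.7 (2) and Def. 6.1 + Thm. 6.2 (ideal form) — each the TYPE of the corresponding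
field of `AcSigned.TransferInputs` VERBATIM — give the whole structure. `torsionFree` is the theorem
`transferInputs_torsionFree_of_setting` ([PR00, §1.3.3] on the tree's carriers); `loc_nonTorsion` (Cor. 6.4) is
derived from the reciprocity field and `L ≠ 0` by `smul_locSignedAt_eq_zero_imp_of_erl` along a structure map
`j : ℤ_p → R₀` compatible with `ℤ_p ⊂ ℂ_p` (`exists_ringHom_padicInt_unrIntegers`), which is print's proof of
Cor. 6.4 ("Immediate from Theorem 6.2 and the non-vanishing result for `𝓛^BDP_𝔭`").
[cite: CastellaWan2023, proof of Thm. 6.8 with (6.12)–(6.13) (MS pp. 29–31), Cor. 6.4 and its proof (MS p. 27)]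
[cite: PerrinRiou1995Asterisque, §1.3.3] -/
theorem transferInputs_of_duality_of_erl (hS : Setting W K p κ 𝔭 𝔭') {γ : absoluteGaloisGroup K}
    (hγ : κ.IsTopGenerator γ) (h𝔭 : IsNonsplitIn κ 𝔭) {γ𝔭 : absoluteGaloisGroup (𝔭.adicCompletion K)}
    (hγ𝔭 : κ (resGalOfEmb (closureEmb (K := K) (𝔭.adicCompletion K)) γ𝔭) = κ γ)
    {ε : ℤˣ} {z : selmerLambdaAdic (W.baseChange K) p κ γ (fun _ ↦ .sgn ε)} {L : UnrSeries p}
    (hL : L ≠ 0)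
    (h613 :
      letI := localSignedLambdaAdic.moduleOfGen ((W.baseChange K).baseChange (𝔭.adicCompletion K)) p
        (localizeAt κ 𝔭 h𝔭) γ𝔭 (isTopGenerator_localize_of_apply_eq p κ _ h𝔭 hγ𝔭 hγ) ε;
      letI := X.moduleOfGen (W.baseChange K) p κ ∅ (PCond.at 𝔭 .rel (.sgn ε)) hγ;
      ∃ δ' : localSignedLambdaAdic ((W.baseChange K).baseChange (𝔭.adicCompletion K)) p
          (localizeAt κ 𝔭 h𝔭) γ𝔭 ε →+ X (W.baseChange K) p κ ∅ (PCond.at 𝔭 .rel (.sgn ε)),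
        (∀ (f : IwasawaAlgebra p)
            (y : localSignedLambdaAdic ((W.baseChange K).baseChange (𝔭.adicCompletion K)) p
              (localizeAt κ 𝔭 h𝔭) γ𝔭 ε),
            δ' (f • y) = IwasawaAlgebra.invol p f • δ' y) ∧
        (∀ y : localSignedLambdaAdic ((W.baseChange K).baseChange (𝔭.adicCompletion K)) p
            (localizeAt κ 𝔭 h𝔭) γ𝔭 ε,
            δ' y = 0 ↔ ∃ x : selmerLambdaAdic (W.baseChange K) p κ γ (fun _ ↦ .sgn ε),
              locSignedAt (W.baseChange K) p κ 𝔭 h𝔭 γ γ𝔭 hγ𝔭 (fun _ ↦ .sgn ε) ε rfl hS.mem x = y) ∧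
        ∀ x' : X (W.baseChange K) p κ ∅ (PCond.at 𝔭 .rel (.sgn ε)),
          (∃ y, δ' y = x') ↔
            x'.comp (AddSubgroup.inclusion (selmer_sgn_le_at_rel (W.baseChange K) p κ ∅ 𝔭 ε)) = 0)
    (h612 :
      letI := localSignedLambdaAdic.moduleOfGen ((W.baseChange K).baseChange (𝔭.adicCompletion K)) p
        (localizeAt κ 𝔭 h𝔭) γ𝔭 (isTopGenerator_localize_of_apply_eq p κ _ h𝔭 hγ𝔭 hγ) ε;
      letI := X.moduleOfGen (W.baseChange K) p κ ∅ (PCond.at 𝔭' .str .rel) hγ;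
      ∃ δ : localSignedLambdaAdic ((W.baseChange K).baseChange (𝔭.adicCompletion K)) p
          (localizeAt κ 𝔭 h𝔭) γ𝔭 ε →+ X (W.baseChange K) p κ ∅ (PCond.at 𝔭' .str .rel),
        (∀ (f : IwasawaAlgebra p)
            (y : localSignedLambdaAdic ((W.baseChange K).baseChange (𝔭.adicCompletion K)) p
              (localizeAt κ 𝔭 h𝔭) γ𝔭 ε),
            δ (f • y) = IwasawaAlgebra.invol p f • δ y) ∧
        (∀ y : localSignedLambdaAdic ((W.baseChange K).baseChange (𝔭.adicCompletion K)) p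
            (localizeAt κ 𝔭 h𝔭) γ𝔭 ε,
            δ y = 0 ↔ ∃ x : selmerLambdaAdic (W.baseChange K) p κ γ (PCond.at 𝔭' .rel (.sgn ε)),
              locSignedAt (W.baseChange K) p κ 𝔭 h𝔭 γ γ𝔭 hγ𝔭 (PCond.at 𝔭' .rel (.sgn ε)) ε
                (PCond.at_of_ne .rel (.sgn ε) (fun h ↦ hS.ne h.symm)) hS.mem x = y) ∧
        ∀ x' : X (W.baseChange K) p κ ∅ (PCond.at 𝔭' .str .rel),
          (∃ y, δ y = x') ↔
            x'.comp (AddSubgroup.inclusion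
              (selmer_at_le_rel_away (W.baseChange K) p κ ∅ .str (.sgn ε))) = 0)
    (h67 :
      (letI := X.moduleOfGen (W.baseChange K) p κ ∅ (PCond.at 𝔭 .rel (.sgn ε)) hγ;
       letI := X.moduleOfGen (W.baseChange K) p κ ∅ (PCond.at 𝔭' .str (.sgn ε)) hγ;
       Module.finrank (IwasawaAlgebra p) (X (W.baseChange K) p κ ∅ (PCond.at 𝔭 .rel (.sgn ε))) =
         1 + Module.finrank (IwasawaAlgebra p) (X (W.baseChange K) p κ ∅ (PCond.at 𝔭' .str (.sgn ε)))) ∧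
      X.torsionCharIdeal (W.baseChange K) p κ ∅ (PCond.at 𝔭 .rel (.sgn ε)) hγ =
        X.torsionCharIdeal (W.baseChange K) p κ ∅ (PCond.at 𝔭' .str (.sgn ε)) hγ)
    (herl :
      ∃ Log : localSignedLambdaAdic ((W.baseChange K).baseChange (𝔭.adicCompletion K)) p
          (localizeAt κ 𝔭 h𝔭) γ𝔭 ε →+ IwasawaAlgebra p,
        IsSignedLog (W.baseChange K) p κ γ hγ 𝔭 h𝔭 γ𝔭 hγ𝔭 ε Log ∧
        ∀ (j : ℤ_[p] →+* unrIntegers p),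
          (∀ x : ℤ_[p], ((j x : unrIntegers p) : ℂ_[p]) = algebraMap ℚ_[p] ℂ_[p] (x : ℚ_[p])) →
          Ideal.span {L} =
            (Ideal.span {IwasawaAlgebra.invol p
              (Log (locSignedAt (W.baseChange K) p κ 𝔭 h𝔭 γ γ𝔭 hγ𝔭 (fun _ ↦ .sgn ε) ε rfl hS.mem z) ^
                2)}).map (PowerSeries.map j)) :
    TransferInputs (W.baseChange K) p κ γ hγ 𝔭 h𝔭 γ𝔭 hγ𝔭 𝔭' (fun h ↦ hS.ne h.symm) hS.mem ε z L := by
  obtain ⟨j, hj⟩ := exists_ringHom_padicInt_unrIntegers p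
  refine ⟨transferInputs_torsionFree_of_setting W K p κ 𝔭 𝔭' hS γ hγ, h613, h612, h67, herl, ?_⟩
  obtain ⟨Log, hLog, he⟩ := herl
  intro f hf
  exact smul_locSignedAt_eq_zero_imp_of_erl (hγ := hγ) hLog.1 hL j (he j hj) f hf

end Assembly

/-! ## §2. The `lemma67` field is clause (2) of conjunct 4 -/

section Lemma67

variable (N : ℕ) [NeZero N] (W : WeierstrassCurve ℚ) [W.IsGloballyMinimal] (K : Type) [Field K]
  [NumberField K] (p : ℕ) [Fact p.Prime] (κ : ZpExtension K p) (𝔭 𝔭' : HeightOneSpectrum (𝓞 K))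

omit [NeZero N] in
/-- **The field `TransferInputs.lemma67` from the named fact Lemma 6.7** (conjunct 4 of `stub_namedFactsSS`,
`castellaWan2024_lemma67_finrank_torsionCharIdeal`): in the `Setting`, for `N = N_E`, the Heegner hypothesis and
`3 < p`, every generator `γ` and sign `ε`, clause (2) of the fact — `rank_Λ X^{rel,ε} = 1 + rank_Λ X^{ε,str}`
and `char_Λ(X^{rel,ε}_tors) = char_Λ(X^{ε,str}_tors)` — is the field's type VERBATIM (same carriers
`AcSigned.X … ∅ (PCond.at 𝔭 .rel (.sgn ε))`, `… (PCond.at 𝔭' .str (.sgn ε))`, same structures `X.moduleOfGen`,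
same `X.torsionCharIdeal`). [cite: CastellaWan2023, Lemma 6.7 (2) (MS p. 28)] -/
theorem lemma67Field_of_lemma67Fact (h67 : castellaWan2024_lemma67_finrank_torsionCharIdeal N W K p κ 𝔭 𝔭')
    (hS : Setting W K p κ 𝔭 𝔭') (hN : (W.conductorNorm ℤ : ℕ) = N) (hH : SatisfiesHeegnerHypothesis N K)
    (hp : 3 < p) (γ : absoluteGaloisGroup K) (hγ : κ.IsTopGenerator γ) (ε : ℤˣ) :
    (letI := X.moduleOfGen (W.baseChange K) p κ ∅ (PCond.at 𝔭 .rel (.sgn ε)) hγ;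
     letI := X.moduleOfGen (W.baseChange K) p κ ∅ (PCond.at 𝔭' .str (.sgn ε)) hγ;
     Module.finrank (IwasawaAlgebra p) (X (W.baseChange K) p κ ∅ (PCond.at 𝔭 .rel (.sgn ε))) =
       1 + Module.finrank (IwasawaAlgebra p) (X (W.baseChange K) p κ ∅ (PCond.at 𝔭' .str (.sgn ε)))) ∧
    X.torsionCharIdeal (W.baseChange K) p κ ∅ (PCond.at 𝔭 .rel (.sgn ε)) hγ =
      X.torsionCharIdeal (W.baseChange K) p κ ∅ (PCond.at 𝔭' .str (.sgn ε)) hγ :=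
  (h67 hS hN hH hp γ hγ ε).2

end Lemma67

/-! ## §3. Conjunct 3 BY NAME from conjunct 4 BY NAME and the inline statement `DualityERL` -/

section Reduction

variable (N : ℕ) [NeZero N] (W : WeierstrassCurve ℚ) [W.IsGloballyMinimal] (K : Type) [Field K]
  [NumberField K] (p : ℕ) [Fact p.Prime] (κ : ZpExtension K p) (𝔭 𝔭' : HeightOneSpectrum (𝓞 K))

/-- **Conjunct 3 of `stub_namedFactsSS` ⟸ conjunct 4 ∧ `DualityERL`.** The named fact
`castellaWan2024_proofThm68_transferInputs N W K p κ 𝔭 𝔭'` follows from the named fact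
`castellaWan2024_lemma67_finrank_torsionCharIdeal N W K p κ 𝔭 𝔭'` (Lemma 6.7) and the inline statement `hD`
("DualityERL"): under the fact's own binders (Setting, `ι` inducing `𝔭`, the newform `f` of `W` of level
`N = N_E`, Heegner hypothesis, `3 < p`, generator `γ`, `h𝔭`, matching local generator `γ_𝔭`) there is a frame
`(Ω_K ≠ 0, Ω_p, L)` with `IsCWBDPLFunction ι 𝔭 κ γ f D_K Ω_K Ω_p L` AND `L ≠ 0`, such that for each sign `ε`
there is `z ∈ Sel_ε(K, 𝐓^ac)` with (6.13), (6.12) and Def. 6.1 + Thm. 6.2 in ideal form — the types of the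
fields `exact613`, `exact612`, `signedLog_erl` of `AcSigned.TransferInputs` VERBATIM. What print supplies for
`hD`: global duality (6.12)–(6.13) (MS p. 30), Thm. 6.2 (MS p. 26) for the class `z^±_∞` of Prop. 4.4 with
Prop. 2.1's `L = ι_Λ(u · L_p^BDP)`, and Thm. 2.3 (`μ(𝓛^BDP_𝔭) = 0`, of which only `L ≠ 0` is used). The two
fields not named in `hD` are supplied by §1 (`torsionFree` a theorem, `loc_nonTorsion` derived).
[cite: CastellaWan2023, proof of Thm. 6.8 with (6.12)–(6.13) (MS pp. 29–31), Thm. 6.2 (MS p. 26), Cor. 6.4 (MS p. 27), Lemma 6.7 (MS p. 28), Thm. 2.3 (MS p. 7)] -/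
theorem proofThm68_transferInputs_of_lemma67_of_dualityERL
    (h67 : castellaWan2024_lemma67_finrank_torsionCharIdeal N W K p κ 𝔭 𝔭')
    (hD : ∀ (hS : Setting W K p κ 𝔭 𝔭') (ι : PadicAlgCl p ≃+* ℂ) {f : CuspForm (CongruenceSubgroup.Gamma0 N) 2}
      (_ : IsNewformOf W f), (W.conductorNorm ℤ : ℕ) = N → SatisfiesHeegnerHypothesis N K → 3 < p →
      (∀ (w : InfinitePlace K) (k : 𝓞 K), k ∈ 𝔭.asIdeal ↔ ‖ι.symm (w.embedding (k : K))‖ < 1) →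
      ∀ (γ : absoluteGaloisGroup K) (hγ : κ.IsTopGenerator γ) (h𝔭 : IsNonsplitIn κ 𝔭)
        (γ𝔭 : absoluteGaloisGroup (𝔭.adicCompletion K))
        (hγ𝔭 : κ (resGalOfEmb (closureEmb (K := K) (𝔭.adicCompletion K)) γ𝔭) = κ γ),
        ∃ (ΩK : ℂ) (Ωp : (unrIntegers p)ˣ) (L : UnrSeries p),
          ΩK ≠ 0 ∧
          IsCWBDPLFunction ι 𝔭 κ γ f (NumberField.discr K) ΩK ((Ωp : unrIntegers p) : ℂ_[p]) L ∧
          L ≠ 0 ∧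
          ∀ ε : ℤˣ, ∃ z : selmerLambdaAdic (W.baseChange K) p κ γ (fun _ ↦ .sgn ε),
            -- (6.13)
            (letI := localSignedLambdaAdic.moduleOfGen ((W.baseChange K).baseChange (𝔭.adicCompletion K)) p
                (localizeAt κ 𝔭 h𝔭) γ𝔭 (isTopGenerator_localize_of_apply_eq p κ _ h𝔭 hγ𝔭 hγ) ε;
              letI := X.moduleOfGen (W.baseChange K) p κ ∅ (PCond.at 𝔭 .rel (.sgn ε)) hγ;
              ∃ δ' : localSignedLambdaAdic ((W.baseChange K).baseChange (𝔭.adicCompletion K)) p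
                  (localizeAt κ 𝔭 h𝔭) γ𝔭 ε →+ X (W.baseChange K) p κ ∅ (PCond.at 𝔭 .rel (.sgn ε)),
                (∀ (g : IwasawaAlgebra p)
                    (y : localSignedLambdaAdic ((W.baseChange K).baseChange (𝔭.adicCompletion K)) p
                      (localizeAt κ 𝔭 h𝔭) γ𝔭 ε),
                    δ' (g • y) = IwasawaAlgebra.invol p g • δ' y) ∧
                (∀ y : localSignedLambdaAdic ((W.baseChange K).baseChange (𝔭.adicCompletion K)) p
                    (localizeAt κ 𝔭 h𝔭) γ𝔭 ε,
                    δ' y = 0 ↔ ∃ x : selmerLambdaAdic (W.baseChange K) p κ γ (fun _ ↦ .sgn ε),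
                      locSignedAt (W.baseChange K) p κ 𝔭 h𝔭 γ γ𝔭 hγ𝔭 (fun _ ↦ .sgn ε) ε rfl hS.mem x =
                        y) ∧
                ∀ x' : X (W.baseChange K) p κ ∅ (PCond.at 𝔭 .rel (.sgn ε)),
                  (∃ y, δ' y = x') ↔
                    x'.comp (AddSubgroup.inclusion
                      (selmer_sgn_le_at_rel (W.baseChange K) p κ ∅ 𝔭 ε)) = 0) ∧
            -- (6.12)
            (letI := localSignedLambdaAdic.moduleOfGen ((W.baseChange K).baseChange (𝔭.adicCompletion K)) p
                (localizeAt κ 𝔭 h𝔭) γ𝔭 (isTopGenerator_localize_of_apply_eq p κ _ h𝔭 hγ𝔭 hγ) ε;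
              letI := X.moduleOfGen (W.baseChange K) p κ ∅ (PCond.at 𝔭' .str .rel) hγ;
              ∃ δ : localSignedLambdaAdic ((W.baseChange K).baseChange (𝔭.adicCompletion K)) p
                  (localizeAt κ 𝔭 h𝔭) γ𝔭 ε →+ X (W.baseChange K) p κ ∅ (PCond.at 𝔭' .str .rel),
                (∀ (g : IwasawaAlgebra p)
                    (y : localSignedLambdaAdic ((W.baseChange K).baseChange (𝔭.adicCompletion K)) p
                      (localizeAt κ 𝔭 h𝔭) γ𝔭 ε),
                    δ (g • y) = IwasawaAlgebra.invol p g • δ y) ∧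
                (∀ y : localSignedLambdaAdic ((W.baseChange K).baseChange (𝔭.adicCompletion K)) p
                    (localizeAt κ 𝔭 h𝔭) γ𝔭 ε,
                    δ y = 0 ↔ ∃ x : selmerLambdaAdic (W.baseChange K) p κ γ (PCond.at 𝔭' .rel (.sgn ε)),
                      locSignedAt (W.baseChange K) p κ 𝔭 h𝔭 γ γ𝔭 hγ𝔭 (PCond.at 𝔭' .rel (.sgn ε)) ε
                        (PCond.at_of_ne .rel (.sgn ε) (fun h ↦ hS.ne h.symm)) hS.mem x = y) ∧
                ∀ x' : X (W.baseChange K) p κ ∅ (PCond.at 𝔭' .str .rel),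
                  (∃ y, δ y = x') ↔
                    x'.comp (AddSubgroup.inclusion
                      (selmer_at_le_rel_away (W.baseChange K) p κ ∅ .str (.sgn ε))) = 0) ∧
            -- Def. 6.1 + Thm. 6.2 (ideal form, tree orientation)
            (∃ Log : localSignedLambdaAdic ((W.baseChange K).baseChange (𝔭.adicCompletion K)) p
                (localizeAt κ 𝔭 h𝔭) γ𝔭 ε →+ IwasawaAlgebra p,
              IsSignedLog (W.baseChange K) p κ γ hγ 𝔭 h𝔭 γ𝔭 hγ𝔭 ε Log ∧
              ∀ (j : ℤ_[p] →+* unrIntegers p),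
                (∀ x : ℤ_[p], ((j x : unrIntegers p) : ℂ_[p]) = algebraMap ℚ_[p] ℂ_[p] (x : ℚ_[p])) →
                Ideal.span {L} =
                  (Ideal.span {IwasawaAlgebra.invol p
                    (Log (locSignedAt (W.baseChange K) p κ 𝔭 h𝔭 γ γ𝔭 hγ𝔭 (fun _ ↦ .sgn ε) ε rfl hS.mem
                      z) ^ 2)}).map (PowerSeries.map j))) :
    castellaWan2024_proofThm68_transferInputs N W K p κ 𝔭 𝔭' := by
  intro hS ι f hf hN hH hp hι γ hγ h𝔭 γ𝔭 hγ𝔭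
  obtain ⟨ΩK, Ωp, L, hΩ, hLf, hL, hε⟩ := hD hS ι hf hN hH hp hι γ hγ h𝔭 γ𝔭 hγ𝔭
  refine ⟨ΩK, Ωp, L, hΩ, hLf, fun ε ↦ ?_⟩
  obtain ⟨z, h613, h612, herl⟩ := hε ε
  exact ⟨z, transferInputs_of_duality_of_erl hS hγ h𝔭 hγ𝔭 hL h613 h612
    (lemma67Field_of_lemma67Fact N W K p κ 𝔭 𝔭' h67 hS hN hH hp γ hγ ε) herl⟩

end Reduction

end Summit.BirchSwinnertonDyer.BirchSwinnertonDyer.Theorems.SignedBaseChangeAcDivTransferInputsOfDuality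

end
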